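import Summits.CriticalPhenomena.PercolationContinuityZ3.Theorems.Transplant.SkelFrmFromBParamsSlotsT
import Summits.CriticalPhenomena.PercolationContinuityZ3.Theorems.Transplant.SkelFrmBParamsSlotsT
import Summits.CriticalPhenomena.PercolationContinuityZ3.Theorems.Transplant.SkelNegBParamsSlotsT
import Summits.CriticalPhenomena.PercolationContinuityZ3.Theorems.Transplant.SkelPhiFaceRunN
import Summits.CriticalPhenomena.PercolationContinuityZ3.Theorems.Transplant.SkelFrmFrom1SlotTypes
import Summits.CriticalPhenomena.PercolationContinuityZ3.Theorems.Transplant.SkelFrm1SlotTypes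
import Summits.CriticalPhenomena.PercolationContinuityZ3.Theorems.Transplant.SkelFrmFrom1ParamsPO
import Summits.CriticalPhenomena.PercolationContinuityZ3.Theorems.Transplant.SkelFrm1ParamsPO
import Summits.CriticalPhenomena.PercolationContinuityZ3.Theorems.Transplant.SkelFrmFrom1ParamsLBL
import Summits.CriticalPhenomena.PercolationContinuityZ3.Theorems.Transplant.SkelFrm1ParamsLBL
import Summits.CriticalPhenomena.PercolationContinuityZ3.Theorems.Transplant.SkelFrmFromBParamsKitA
import Summits.CriticalPhenomena.PercolationContinuityZ3.Theorems.Transplant.SkelFrmBParamsKitA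
import Summits.CriticalPhenomena.PercolationContinuityZ3.Theorems.Transplant.SkelFrmFromBParamsKitS
import Summits.CriticalPhenomena.PercolationContinuityZ3.Theorems.Transplant.SkelFrmBParamsKitS
import Summits.CriticalPhenomena.PercolationContinuityZ3.Theorems.Transplant.SkelFrmFrom1ParamsLF
import Summits.CriticalPhenomena.PercolationContinuityZ3.Theorems.Transplant.SkelFrm1ParamsLF
import Summits.CriticalPhenomena.PercolationContinuityZ3.Theorems.Transplant.SkelFrmFrom1ParamsLO
import Summits.CriticalPhenomena.PercolationContinuityZ3.Theorems.Transplant.SkelFrm1ParamsLO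
import Summits.CriticalPhenomena.PercolationContinuityZ3.Theorems.Transplant.SkelFrmFromBParamsLF
import Summits.CriticalPhenomena.PercolationContinuityZ3.Theorems.Transplant.SkelFrmBParamsLF
import Summits.CriticalPhenomena.PercolationContinuityZ3.Theorems.Transplant.SkelFrmFromBParamsFineSize
import Summits.CriticalPhenomena.PercolationContinuityZ3.Theorems.Transplant.SkelFrmBParamsFineSize
import Summits.CriticalPhenomena.PercolationContinuityZ3.Theorems.Transplant.SkelFrmFromBParamsLO
import Summits.CriticalPhenomena.PercolationContinuityZ3.Theorems.Transplant.SkelFrmBParamsLO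
import Summits.CriticalPhenomena.PercolationContinuityZ3.Theorems.Transplant.SkelFrmFromBParamsB
import Summits.CriticalPhenomena.PercolationContinuityZ3.Theorems.Transplant.SkelFrmBParamsB
import Summits.CriticalPhenomena.PercolationContinuityZ3.Theorems.Transplant.SkelFrmFromBParamsSlotsR
import Summits.CriticalPhenomena.PercolationContinuityZ3.Theorems.Transplant.SkelFrmBParamsSlotsR
import Summits.CriticalPhenomena.PercolationContinuityZ3.Theorems.Transplant.SkelFrmFromBParamsSlotsRS
import Summits.CriticalPhenomena.PercolationContinuityZ3.Theorems.Transplant.SkelFrmBParamsSlotsRS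
import Summits.CriticalPhenomena.PercolationContinuityZ3.Theorems.Transplant.SkelFrmFromBParamsSlots
import Summits.CriticalPhenomena.PercolationContinuityZ3.Theorems.Transplant.SkelFrmBParamsSlots
import Summits.CriticalPhenomena.PercolationContinuityZ3.Theorems.Transplant.SkelFrmFromBParamsSched
import Summits.CriticalPhenomena.PercolationContinuityZ3.Theorems.Transplant.SkelFrmBParamsSched
import Summits.CriticalPhenomena.PercolationContinuityZ3.Theorems.Transplant.SkelFrmFromBParamsReachFC
import Summits.CriticalPhenomena.PercolationContinuityZ3.Theorems.Transplant.SkelFrmBParamsReachFC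
import Summits.CriticalPhenomena.PercolationContinuityZ3.Theorems.Transplant.SkelNegBParamsFaceLat
import Summits.CriticalPhenomena.PercolationContinuityZ3.Theorems.Transplant.PlanarSkeletonFrmFromDefs
import Summits.CriticalPhenomena.PercolationContinuityZ3.Theorems.Transplant.PlanarSkeletonFrmDefs
import Summits.CriticalPhenomena.PercolationContinuityZ3.Theorems.Transplant.SkelPhiStepIDataNS
import HarnessLib
import Summits.CriticalPhenomena.PercolationContinuityZ3.Theorems.Transplant.SkelFrmBParamsFaceLat
/-!
# U-WAVE PORT (RULING D-U, lead g21 2026-08-26; WAVE-U-MANIFEST v3.1 row «SkelFrmBParamsFaceLat» ↦ «SkelFrmFromBParamsFaceLat») of the tree module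
# `Transplant/SkelFrmBParamsFaceLat` onto the carrier `PlanarSkeletonFrmFrom` (frames only, cylinders connected from width `ℓ₀` on)

ORIGINAL TITLE: N2 (frames-only node `SamePDropOfSkeletonFrmFrom₁`, OPEN) params column over `PlanarSkeletonFrm` — (ζ″) ledger, shape (B′) of record ((R-14)):

builds on p205010 (kernel theorem, internal audit signed; external expert review pending) — nothing in this file uses p205010; NOTHING is claimed about the
OPEN node U `SamePDropOfSkeletonFrmFrom₁` (nor U_s / the end state).  Lane `prim-bschramm`, seat `prim-bschramm-stmt` gen 26 (port pen, RULING M-11 family P-stmt; tool = p3-g26's port_u.py of record, registry-driven inputs); helper file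
(`--supports stmt-CriticalPhenomena-4575 --as helper`).  PORT RULES r1–r4 of RULING D-U: declaration order and proof texts are those of the original,
byte-identical except (i) the carrier token `PlanarSkeletonFrm ↦ PlanarSkeletonFrmFrom` (binders, `namespace`/`end` lines, qualified names of twinned
declarations), (ii) carrier-FREE declarations of the original (φ-level `Skelφ…` blocks and namespace-only arithmetic residents) are NOT re-declared —
this file imports the original and `export`s the twin-free residents (POLICY T / treatment (m1)); residents whose statement mentions a twinned
constant are copied, (iii) every carrier-binding declaration keeps its explicit binder `(Φ : PlanarSkeletonFrmFrom G)` in its own signature (r2).  Docstrings and citations are the original's.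
-/

noncomputable section

open scoped Classical

namespace Summit.CriticalPhenomena.PercolationContinuityZ3.Theorems.Transplant

namespace PlanarSkeletonFrmFrom

namespace NegB

open Literature.Probability.Percolation Literature.Probability.LatticeModels SimpleGraph
open SkelConc (Consts)
open Skelφ.StepI (DataN)
open TwoAxis.Para (modulus)
open Literature.Probability.Percolation.KozmaNitzan.Cells (oth)
open Neg

section Lat

/-! ## §1 The lattice bounds -/

/-- `prF.L 0 = 800·L̂₀` and `prF.L 1 = 800·L̂₁` (under `1 ≤ n_L`). [folklore] -/
theorem L_eq (κ : Consts) {V : Type} [DecidableEq V] [Countable V] {G : SimpleGraph V} [G.LocallyFinite] (Φ : PlanarSkeletonFrmFrom G) (t : V) (p : unitInterval) (D : Skelφ.StepI.DataNS V) (g : ℕ) (f : ℕ) :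
    (prF κ Φ t p D g f).L 0 = 800 * Skelφ.NegPrm.L0hat (nL κ Φ t p D g f) (hL κ Φ t p D g f) (ℓL κ Φ t p D g f) (vL κ Φ t p D g f) ∧
      (prF κ Φ t p D g f).L 1 = 800 * Skelφ.NegPrm.L1hat (nL κ Φ t p D g f) (hL κ Φ t p D g f) := by
  obtain ⟨hA, hn, hh, hvα, hvβ, -, -, -⟩ := prF_fields κ Φ t p D g f
  have hn0 : (0 : ℤ) ≤ (nL κ Φ t p D g f : ℤ) := by positivity
  unfold Skelφ.FinePrm.L Skelφ.NegPrm.L0hat Skelφ.NegPrm.L1hat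
  simp only [Skelφ.FinePrm.lvGen_zero_zero, Skelφ.FinePrm.lvGen_zero_one, Skelφ.FinePrm.lvGen_one_zero, Skelφ.FinePrm.lvGen_one_one, hA, hn, hh, hvα, hvβ]
  refine ⟨by unfold vβL; simp only [abs_of_nonneg (show (0:ℤ) ≤ 800 by norm_num)]; ring, ?_⟩
  rw [abs_of_nonneg (show (0:ℤ) ≤ 800 by norm_num), abs_of_nonneg hn0]

/-- **Upper**: `c_I·L_I + 2 ≤ D` (`prF_room`). [folklore] -/
theorem cL_upper (κ : Consts) {V : Type} [DecidableEq V] [Countable V] {G : SimpleGraph V} [G.LocallyFinite] (Φ : PlanarSkeletonFrmFrom G) (t : V) (p : unitInterval) (D : Skelφ.StepI.DataNS V) (g : ℕ) (f : ℕ) (hN : EqNumL κ Φ t p D g f) (I : Fin 2) : (prF κ Φ t p D g f).cOf I * (prF κ Φ t p D g f).L I + 2 ≤ (prF κ Φ t p D g f).D := by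
  obtain ⟨h0, h1⟩ := prF_room κ Φ t p D g f hN
  obtain rfl | rfl : I = 0 ∨ I = 1 := by fin_cases I <;> simp
  · rwa [Skelφ.FinePrm.cOf_zero]
  · rwa [Skelφ.FinePrm.cOf_one]

/-- **Lower**: `11·D < 13·(c_I·L_I)` whenever `11 ≤ s_I` (from `D < (m_I+1)·20K·800·L̂_I`, `c_I·L_I = 20K·s_I·800·L̂_I`, `s_I = m_I − 1`). [folklore] -/
theorem cL_lower (κ : Consts) {V : Type} [DecidableEq V] [Countable V] {G : SimpleGraph V} [G.LocallyFinite] (Φ : PlanarSkeletonFrmFrom G) (t : V) (p : unitInterval) (D : Skelφ.StepI.DataNS V) (g : ℕ) (f : ℕ) (hN : EqNumL κ Φ t p D g f) (I : Fin 2) (hs : 11 ≤ (fcells κ Φ t p D g f).s I) :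
    11 * (prF κ Φ t p D g f).D < 13 * ((prF κ Φ t p D g f).cOf I * (prF κ Φ t p D g f).L I) := by
  obtain ⟨hL0, hL1⟩ := L_eq κ Φ t p D g f
  obtain ⟨-, -, -, -, -, hc0, hc1, hD⟩ := prF_fields κ Φ t p D g f
  obtain ⟨hs0, hs1⟩ := fcells_s_at κ Φ t p D g f hN
  obtain ⟨hlt0, hlt1⟩ := mOf_floor_lt κ Φ t p D g f hN
  have hK := (fcells_K κ Φ t p D g f).1
  have hL0nn := Skelφ.NegPrm.Lhat_nonneg (nL κ Φ t p D g f) (hL κ Φ t p D g f) (ℓL κ Φ t p D g f) (vL κ Φ t p D g f)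
  have hK40 : (40 : ℤ) ≤ Neg.K κ := by exact_mod_cast (Neg.forty_le_K κ).1
  obtain rfl | rfl : I = 0 ∨ I = 1 := by fin_cases I <;> simp
  · rw [Skelφ.FinePrm.cOf_zero, hc0, hL0, hD, hK]
    have hs' : (11 : ℤ) ≤ (((fcells κ Φ t p D g f).s 0 : ℕ) : ℤ) := by exact_mod_cast hs
    have e : m0 κ Φ t p D g f = (((fcells κ Φ t p D g f).s 0 : ℕ) : ℤ) + 1 := by rw [hs0]; unfold fm0; ring
    rw [e] at hlt0
    set u : ℤ := 20 * (Neg.K κ : ℤ) * (800 * Skelφ.NegPrm.L0hat (nL κ Φ t p D g f) (hL κ Φ t p D g f) (ℓL κ Φ t p D g f) (vL κ Φ t p D g f)) with hu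
    have hu0 : 0 ≤ u := by rw [hu]; have := hL0nn.1; positivity
    have h13 : 11 * ((((fcells κ Φ t p D g f).s 0 : ℕ) : ℤ) + 1 + 1) ≤ 13 * (((fcells κ Φ t p D g f).s 0 : ℕ) : ℤ) := by linarith
    have h1 : 11 * Skelφ.NegPrm.Dof (nL κ Φ t p D g f) (hL κ Φ t p D g f) (ℓL κ Φ t p D g f) (vL κ Φ t p D g f) <
        11 * (((((fcells κ Φ t p D g f).s 0 : ℕ) : ℤ) + 1 + 1) * u) := by linarith
    have h2 : 11 * (((((fcells κ Φ t p D g f).s 0 : ℕ) : ℤ) + 1 + 1) * u) ≤ 13 * ((((fcells κ Φ t p D g f).s 0 : ℕ) : ℤ) * u) := by nlinarith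
    have e2 : 20 * (Neg.K κ : ℤ) * (((fcells κ Φ t p D g f).s 0 : ℕ) : ℤ) * (800 * Skelφ.NegPrm.L0hat (nL κ Φ t p D g f) (hL κ Φ t p D g f) (ℓL κ Φ t p D g f) (vL κ Φ t p D g f)) =
        (((fcells κ Φ t p D g f).s 0 : ℕ) : ℤ) * u := by rw [hu]; ring
    rw [e2]; linarith
  · rw [Skelφ.FinePrm.cOf_one, hc1, hL1, hD, hK]
    have hs' : (11 : ℤ) ≤ (((fcells κ Φ t p D g f).s 1 : ℕ) : ℤ) := by exact_mod_cast hs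
    have e : m1 κ Φ t p D g f = (((fcells κ Φ t p D g f).s 1 : ℕ) : ℤ) + 1 := by rw [hs1]; unfold fm1; ring
    rw [e] at hlt1
    set u : ℤ := 20 * (Neg.K κ : ℤ) * (800 * Skelφ.NegPrm.L1hat (nL κ Φ t p D g f) (hL κ Φ t p D g f)) with hu
    have hu0 : 0 ≤ u := by rw [hu]; have := hL0nn.2; positivity
    have h1 : 11 * Skelφ.NegPrm.Dof (nL κ Φ t p D g f) (hL κ Φ t p D g f) (ℓL κ Φ t p D g f) (vL κ Φ t p D g f) <
        11 * (((((fcells κ Φ t p D g f).s 1 : ℕ) : ℤ) + 1 + 1) * u) := by linarith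
    have h2 : 11 * (((((fcells κ Φ t p D g f).s 1 : ℕ) : ℤ) + 1 + 1) * u) ≤ 13 * ((((fcells κ Φ t p D g f).s 1 : ℕ) : ℤ) * u) := by nlinarith
    have e2 : 20 * (Neg.K κ : ℤ) * (((fcells κ Φ t p D g f).s 1 : ℕ) : ℤ) * (800 * Skelφ.NegPrm.L1hat (nL κ Φ t p D g f) (hL κ Φ t p D g f)) =
        (((fcells κ Φ t p D g f).s 1 : ℕ) : ℤ) * u := by rw [hu]; ring
    rw [e2]; linarith

/-- **The raw axis carries half the generator**: `c_I·L_I ≤ 1600·rdK I (bOf I)` (`L_I = 800·(|lv 0|+|lv 1|)`, `|lv (bOf I)| ≥ |lv (oth (bOf I))|`). [folklore] -/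
theorem rdK_lower (κ : Consts) {V : Type} [DecidableEq V] [Countable V] {G : SimpleGraph V} [G.LocallyFinite] (Φ : PlanarSkeletonFrmFrom G) (t : V) (p : unitInterval) (D : Skelφ.StepI.DataNS V) (g : ℕ) (f : ℕ) (I : Fin 2) : (prF κ Φ t p D g f).cOf I * (prF κ Φ t p D g f).L I ≤ 1600 * (prF κ Φ t p D g f).rdK I ((prF κ Φ t p D g f).bOf I) := by
  set pr := prF κ Φ t p D g f
  have hA : pr.A = 800 := (prF_fields κ Φ t p D g f).1
  have hb := pr.abs_lvGen_oth_bOf_le I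
  have hc : 0 ≤ pr.cOf I := (pr.cOf_pos (prF_c_pos κ Φ t p D g f).1 (prF_c_pos κ Φ t p D g f).2 I).le
  unfold Skelφ.FinePrm.rdK Skelφ.FinePrm.L
  rw [hA, abs_of_nonneg (show (0:ℤ) ≤ 800 by norm_num)]
  have hsum : |pr.lvGen I 0| + |pr.lvGen I 1| ≤ 2 * |pr.lvGen I (pr.bOf I)| := by
    have : pr.bOf I = 0 ∨ pr.bOf I = 1 := by
      generalize pr.bOf I = b; fin_cases b <;> simp
    rcases this with h0 | h1
    · rw [h0] at hb ⊢; have : oth (0 : Fin 2) = 1 := rfl; rw [this] at hb; linarith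
    · rw [h1] at hb ⊢; have : oth (1 : Fin 2) = 0 := rfl; rw [this] at hb; linarith
  nlinarith

/-- **The other generator is at most `D/800`**: `800·rdN I b ≤ D` for every `b` (`rdN I b = c_J·|lv_J b| ≤ c_J·L_J/800 ≤ D/800`). [folklore] -/
theorem rdN_upper (κ : Consts) {V : Type} [DecidableEq V] [Countable V] {G : SimpleGraph V} [G.LocallyFinite] (Φ : PlanarSkeletonFrmFrom G) (t : V) (p : unitInterval) (D : Skelφ.StepI.DataNS V) (g : ℕ) (f : ℕ) (hN : EqNumL κ Φ t p D g f) (I b : Fin 2) : 800 * (prF κ Φ t p D g f).rdN I b ≤ (prF κ Φ t p D g f).D := by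
  set pr := prF κ Φ t p D g f
  have hA : pr.A = 800 := (prF_fields κ Φ t p D g f).1
  have hJ := cL_upper κ Φ t p D g f hN (oth I)
  have hc : 0 ≤ pr.cOf (oth I) := (pr.cOf_pos (prF_c_pos κ Φ t p D g f).1 (prF_c_pos κ Φ t p D g f).2 (oth I)).le
  have hle : |pr.lvGen (oth I) b| ≤ |pr.lvGen (oth I) 0| + |pr.lvGen (oth I) 1| := by
    obtain rfl | rfl : b = 0 ∨ b = 1 := by fin_cases b <;> simp
    · linarith [abs_nonneg (pr.lvGen (oth I) 1)]
    · linarith [abs_nonneg (pr.lvGen (oth I) 0)]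
  have hL : pr.L (oth I) = 800 * (|pr.lvGen (oth I) 0| + |pr.lvGen (oth I) 1|) := by
    unfold Skelφ.FinePrm.L; rw [hA, abs_of_nonneg (show (0:ℤ) ≤ 800 by norm_num)]
  unfold Skelφ.FinePrm.rdN
  rw [hL] at hJ
  nlinarith

/-- **`800·Mabs = c₀·c₁·D`** (`D = 800²·modulus`, `modulus > 0`). [folklore] -/
theorem Mabs_eq (κ : Consts) {V : Type} [DecidableEq V] [Countable V] {G : SimpleGraph V} [G.LocallyFinite] (Φ : PlanarSkeletonFrmFrom G) (t : V) (p : unitInterval) (D : Skelφ.StepI.DataNS V) (g : ℕ) (f : ℕ) (hN : EqNumL κ Φ t p D g f) : 800 * (prF κ Φ t p D g f).Mabs = (prF κ Φ t p D g f).c₀ * (prF κ Φ t p D g f).c₁ * (prF κ Φ t p D g f).D := by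
  set pr := prF κ Φ t p D g f
  have hA : pr.A = 800 := (prF_fields κ Φ t p D g f).1
  have hm := (prF_pos κ Φ t p D g f hN).2.2.1
  have hDd : pr.D = TwoAxis.Para.detD pr.A pr.n pr.h pr.vα pr.vβ := prF_D κ Φ t p D g f
  unfold Skelφ.FinePrm.Mabs
  rw [hDd]; unfold TwoAxis.Para.detD; rw [hA, abs_of_pos (by positivity)]
  ring

/-! ## §2 The first consequence: the `k₀` ceiling is at most `3`, and `hk₀'` -/

/-- `0 < rdK I (bOf I)` at the frame record (twin of hp-8's `FinePrm.rdK_pos`, stated here to keep this file independent of `SkelPhiFaceSlots`). [folklore] -/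
theorem rdK_pos_R (κ : Consts) {V : Type} [DecidableEq V] [Countable V] {G : SimpleGraph V} [G.LocallyFinite] (Φ : PlanarSkeletonFrmFrom G) (t : V) (p : unitInterval) (D : Skelφ.StepI.DataNS V) (g : ℕ) (f : ℕ) (hN : EqNumL κ Φ t p D g f) (I : Fin 2) : 0 < (prF κ Φ t p D g f).rdK I ((prF κ Φ t p D g f).bOf I) := by
  set pr := prF κ Φ t p D g f
  unfold Skelφ.FinePrm.rdK
  exact mul_pos (pr.cOf_pos (prF_c_pos κ Φ t p D g f).1 (prF_c_pos κ Φ t p D g f).2 I)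
    (abs_pos.2 (pr.lvGen_bOf_ne_zero I (pr.lvGen_ne_zero_of_detD_pos (prF_D κ Φ t p D g f) (prF_pos κ Φ t p D g f hN).2.2.2.2.2 I)))

/-- **The `k₀` ceilings are at most `3`**: `⌈rdN I (bOf I) / rdK I (bOf I)⌉ = (rdN + rdK − 1)/rdK ≤ 3` whenever `11 ≤ s_I` (`rdN ≤ D/800 ≤ 3·(11D/(13·1600)) ≤ 3·rdK`) — so
hp-8's `k₀F = max_I ⌈…⌉ ≤ 3`. [folklore] -/
theorem k₀_ceil_le_three (κ : Consts) {V : Type} [DecidableEq V] [Countable V] {G : SimpleGraph V} [G.LocallyFinite] (Φ : PlanarSkeletonFrmFrom G) (t : V) (p : unitInterval) (D : Skelφ.StepI.DataNS V) (g : ℕ) (f : ℕ) (hN : EqNumL κ Φ t p D g f) (I : Fin 2) (hs : 11 ≤ (fcells κ Φ t p D g f).s I) :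
    ((prF κ Φ t p D g f).rdN I ((prF κ Φ t p D g f).bOf I) + (prF κ Φ t p D g f).rdK I ((prF κ Φ t p D g f).bOf I) - 1) /
        (prF κ Φ t p D g f).rdK I ((prF κ Φ t p D g f).bOf I) ≤ 3 := by
  have h1 := cL_lower κ Φ t p D g f hN I hs
  have h2 := rdK_lower κ Φ t p D g f I
  have h3 := rdN_upper κ Φ t p D g f hN I ((prF κ Φ t p D g f).bOf I)
  have hpos := rdK_pos_R κ Φ t p D g f hN I
  have h4 : (prF κ Φ t p D g f).rdN I ((prF κ Φ t p D g f).bOf I) ≤ 3 * (prF κ Φ t p D g f).rdK I ((prF κ Φ t p D g f).bOf I) := by nlinarith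
  have h5 : (prF κ Φ t p D g f).rdN I ((prF κ Φ t p D g f).bOf I) + (prF κ Φ t p D g f).rdK I ((prF κ Φ t p D g f).bOf I) - 1 < 4 * (prF κ Φ t p D g f).rdK I ((prF κ Φ t p D g f).bOf I) := by linarith
  have := Int.ediv_lt_of_lt_mul hpos h5
  omega

/-- `3·rdK ≥ rdN` in the product form hp-8's `hk₀` consumes (`rdN I (bOf I) ≤ rdK I (bOf I) * 3`). [folklore] -/
theorem rdN_le_three_rdK (κ : Consts) {V : Type} [DecidableEq V] [Countable V] {G : SimpleGraph V} [G.LocallyFinite] (Φ : PlanarSkeletonFrmFrom G) (t : V) (p : unitInterval) (D : Skelφ.StepI.DataNS V) (g : ℕ) (f : ℕ) (hN : EqNumL κ Φ t p D g f) (I : Fin 2) (hs : 11 ≤ (fcells κ Φ t p D g f).s I) :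
    (prF κ Φ t p D g f).rdN I ((prF κ Φ t p D g f).bOf I) ≤ (prF κ Φ t p D g f).rdK I ((prF κ Φ t p D g f).bOf I) * 3 := by
  have h1 := cL_lower κ Φ t p D g f hN I hs
  have h2 := rdK_lower κ Φ t p D g f I
  have h3 := rdN_upper κ Φ t p D g f hN I ((prF κ Φ t p D g f).bOf I)
  have hpos := rdK_pos_R κ Φ t p D g f hN I
  nlinarith

/-- `11 ≤ s_i` at `g := KS.gT` (from `cells_geT`: `6·RA' + 11 ≤ s₀`, `14·RA' + 27 ≤ s₁`). [folklore] -/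
theorem eleven_le_s_T (κ : Consts) {V : Type} [DecidableEq V] [Countable V] {G : SimpleGraph V} [G.LocallyFinite] (Φ : PlanarSkeletonFrmFrom G) (t : V) (p : unitInterval) (D : Skelφ.StepI.DataNS V) (f : ℕ) (mk : ℕ) (gx : Neg.FSlot) (hN : EqNumL κ Φ t p D (KS.gT mk gx κ Φ t p D) f) (hκ : (hL κ Φ t p D (KS.gT mk gx κ Φ t p D) f).natAbs ≤ 10 * nL κ Φ t p D (KS.gT mk gx κ Φ t p D) f)
    (i : Fin 2) : 11 ≤ (fcells κ Φ t p D (KS.gT mk gx κ Φ t p D) f).s i := by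
  obtain ⟨hs0, hs1⟩ := KS.cells_geT κ Φ t p D mk gx f hN hκ
  obtain rfl | rfl : i = 0 ∨ i = 1 := by fin_cases i <;> simp
  · have : (11 : ℤ) ≤ (((fcells κ Φ t p D (KS.gT mk gx κ Φ t p D) f).s 0 : ℕ) : ℤ) := by linarith
    exact_mod_cast this
  · have : (11 : ℤ) ≤ (((fcells κ Φ t p D (KS.gT mk gx κ Φ t p D) f).s 1 : ℕ) : ℤ) := by linarith
    exact_mod_cast this

/-- **`hk₀'` AT THE VALUES** for any `k₀ ≤ 3` (`g := KS.gT`, any `f`): `∀ i, 3·r i + k₀ + 3 ≤ 5·r i` (`r_i = K·s_i ≥ 40·11`). [folklore] -/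
theorem hk₀'_R (κ : Consts) {V : Type} [DecidableEq V] [Countable V] {G : SimpleGraph V} [G.LocallyFinite] (Φ : PlanarSkeletonFrmFrom G) (t : V) (p : unitInterval) (D : Skelφ.StepI.DataNS V) (f : ℕ) (mk : ℕ) (gx : Neg.FSlot) (hN : EqNumL κ Φ t p D (KS.gT mk gx κ Φ t p D) f) (hκ : (hL κ Φ t p D (KS.gT mk gx κ Φ t p D) f).natAbs ≤ 10 * nL κ Φ t p D (KS.gT mk gx κ Φ t p D) f)
    {k₀ : ℤ} (hk : k₀ ≤ 3) (i : Fin 2) :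
    3 * ((fcells κ Φ t p D (KS.gT mk gx κ Φ t p D) f).r i : ℤ) + k₀ + 3 ≤ 5 * ((fcells κ Φ t p D (KS.gT mk gx κ Φ t p D) f).r i : ℤ) := by
  have hs := eleven_le_s_T κ Φ t p D f mk gx hN hκ i
  have hr := (fcells_K κ Φ t p D (KS.gT mk gx κ Φ t p D) f).2.2 i
  have hK := (Neg.forty_le_K κ).1
  have : 440 ≤ (fcells κ Φ t p D (KS.gT mk gx κ Φ t p D) f).r i := by rw [hr]; nlinarith
  have : (440 : ℤ) ≤ ((fcells κ Φ t p D (KS.gT mk gx κ Φ t p D) f).r i : ℤ) := by exact_mod_cast this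
  linarith

end Lat

end NegB

end PlanarSkeletonFrmFrom

end Summit.CriticalPhenomena.PercolationContinuityZ3.Theorems.Transplant

end
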